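import Mathlib
import Literature.Analysis.FluidPDE.IsometryInvariance
import Literature.Analysis.FluidPDE.CurlIsometryCovariance
import Literature.Analysis.FluidPDE.BiotSavartNewtonKernel
import Summits.NavierStokesRegularity.NavierStokesRegularity.Theorems.ThreadingFluxCentreJetTriaxialFrame
import Summits.NavierStokesRegularity.NavierStokesRegularity.Theorems.ThreadingFluxCentreJetHarmonicTangentDegreeTwo
import HarnessLib

/-!
# Crux `PoloidalLiouville` (stmt-NavierStokesRegularity-1222, wall W1), crux idea «steady-centre-sieve» (ns-idea-15):
# FRAME + POLYNOMIAL FORM, DEGREE TWO — jet facts of a quadratic term ⇒ it is a multiple of the POLHODE FIELD `y × Sy`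

Support file (`--supports stmt-NavierStokesRegularity-1222`, helper; cell `ns-wall-extremal`, ns-wall-eng-7 g6, 0 kit).  Degree-two companion
of `TriaxialFrame.eq_zero_of_jetFacts` (file (4) of L1): a smooth 2-homogeneous field `P : ℝ³ → ℝ³`, tangent to the spheres about `0`,
divergence free, harmonic, with the loop law `⟪y, DP(y)[Sy] − S P(y)⟫ = 0` against an `S` with an orthonormal eigenbasis and distinct
eigenvalues summing to `0`, is `P(y) = μ · y × Sy` for some real `μ` (`eq_smul_cross_of_jetFacts_two`; the diagonal frame
`eq_smul_cross_of_jetFacts_two_diag` rests on `HarmonicTangent.eq_smul_eulerTop_of_degree_two`; the general frame uses the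
pseudo-vector law `cross (R a) (R b) = det R • R (cross a b)` (`cross_map_linearIsometryEquiv`, from the tree's
`curlCLM_conj_linearIsometryEquiv` applied to the rank-one map `y ↦ ⟪a,y⟫ b`, whose `curlCLM` is `a × b`).  This is the algebra behind the card's «T₂ = λ⟪y,Sy⟫ is forced — vortex lines are polhodes» (docstring of C1″).

HONEST FRAME: helper about one crux idea's objects; closes no crux or sketch Prop; `PoloidalLiouville` (1222) and NS regularity OPEN.
-/

-- the summit and its single sub-problem share the name (CONVENTIONS §1)
set_option linter.dupNamespace false

noncomputable section

namespace Summit.NavierStokesRegularity.NavierStokesRegularity.Theorems.PoloidalLiouville.CentreJet.TriaxialFrame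

open Set Function MvPolynomial
open scoped ContDiff RealInnerProductSpace
open Literature.Analysis.FluidPDE
open Literature.Geometry.DiscreteGeometry (inner_fin3)
open Summit.NavierStokesRegularity.NavierStokesRegularity.Theorems.PoloidalLiouville.HorizonTower.Zonal
  (evalE evalE_add evalE_mul evalE_X evalE_C evalE_sub evalE_zero fderiv_evalE_apply laplacian_evalE lapP
    eq_zero_of_evalE_eq_zero exists_mvPolynomial_of_homogeneous contDiff_evalE differentiable_evalE)

/-! ### The cross product is a pseudo-vector -/

/-- **Pseudo-vector law**: `cross (R a) (R b) = det R • R (cross a b)` for a linear isometry `R` of `ℝ³` (from the tree's covariance of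
`curlCLM` under conjugation, applied to the rank-one map `y ↦ ⟪a, y⟫ b` whose `curlCLM` is `a × b`). -/
theorem cross_map_linearIsometryEquiv (R : E3 ≃ₗᵢ[ℝ] E3) (a b : E3) :
    cross (R a) (R b) = (R : E3 →L[ℝ] E3).det • R (cross a b) := by
  have h := curlCLM_conj_linearIsometryEquiv R ((innerSL ℝ a).smulRight b)
  have hconj : (R : E3 →L[ℝ] E3).comp (((innerSL ℝ a).smulRight b).comp (R.symm : E3 →L[ℝ] E3)) =
      (innerSL ℝ (R a)).smulRight (R b) := by
    refine ContinuousLinearMap.ext fun y => ?_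
    show R (⟪a, R.symm y⟫ • b) = ⟪R a, y⟫ • R b
    rw [map_smul, ← R.inner_map_map a (R.symm y), LinearIsometryEquiv.apply_symm_apply]
  rw [hconj, curlCLM_smulRight_innerSL, curlCLM_smulRight_innerSL] at h
  exact h

/-- The Euler-top field evaluated: `Wᵢ(y) = (y × Ty)ᵢ` for `T = diag(a)`. -/
theorem evalE_eulerTopField (a : Fin 3 → ℝ) (T : E3 →L[ℝ] E3) (hT : ∀ (w : E3) (i : Fin 3), T w i = a i * w i) (y : E3)
    (i : Fin 3) : evalE (eulerTopField a i) y = cross y (T y) i := by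
  have h0 := hT y 0; have h1 := hT y 1; have h2 := hT y 2
  fin_cases i
  · simp only [Fin.zero_eta, Fin.isValue, eulerTopField_zero, evalE_mul, evalE_C, evalE_X]
    simp only [cross, cross_apply, Fin.isValue, WithLp.ofLp_toLp, Matrix.cons_val_zero]
    rw [show (T y).ofLp 2 = T y 2 from rfl, show (T y).ofLp 1 = T y 1 from rfl, h1, h2]
    ring
  · simp only [Fin.mk_one, Fin.isValue, eulerTopField_one, evalE_mul, evalE_C, evalE_X]
    simp only [cross, cross_apply, Fin.isValue, WithLp.ofLp_toLp, Matrix.cons_val_one, Matrix.cons_val_zero]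
    rw [show (T y).ofLp 2 = T y 2 from rfl, show (T y).ofLp 0 = T y 0 from rfl, h0, h2]
    ring
  · simp only [Fin.reduceFinMk, Fin.isValue, eulerTopField_two, evalE_mul, evalE_C, evalE_X]
    simp only [cross, cross_apply, Fin.isValue, WithLp.ofLp_toLp, Matrix.cons_val_two, Matrix.tail_cons, Matrix.head_cons]
    rw [show (T y).ofLp 0 = T y 0 from rfl, show (T y).ofLp 1 = T y 1 from rfl, h0, h1]
    ring

/-- **Degree two, diagonal frame**: a smooth `2`-homogeneous field, tangent to spheres, divergence free, harmonic, with the loop law against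
`T = diag(a)` (`a` injective, `Σ aᵢ = 0`), is `μ · y × Ty`. -/
theorem eq_smul_cross_of_jetFacts_two_diag (Q : E3 → E3) (hQ : ContDiff ℝ ∞ Q)
    (hhom : ∀ (c : ℝ) (y : E3), Q (c • y) = c ^ 2 • Q y) (hdiv : ∀ y, VectorCalculus.divergence Q y = 0)
    (htan : ∀ y, ⟪y, Q y⟫ = 0) (hharm : ∀ y, Laplacian.laplacian Q y = 0) (a : Fin 3 → ℝ) (ha : Function.Injective a)
    (hsum : ∑ i, a i = 0) (T : E3 →L[ℝ] E3) (hT : ∀ (w : E3) (i : Fin 3), T w i = a i * w i)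
    (hloop : ∀ y, ⟪y, fderiv ℝ Q y (T y) - T (Q y)⟫ = 0) : ∃ μ : ℝ, ∀ y, Q y = μ • cross y (T y) := by
  classical
  have hcomp : ∀ i : Fin 3, ∃ q : MvPolynomial (Fin 3) ℝ, q.IsHomogeneous 2 ∧ ∀ y : E3, Q y i = evalE q y := by
    intro i
    refine exists_mvPolynomial_of_homogeneous ((EuclideanSpace.proj i : E3 →L[ℝ] ℝ).contDiff.comp hQ) ?_
    intro c y
    show Q (c • y) i = c ^ 2 * Q y i
    rw [hhom]; rfl
  choose q hqh hq using hcomp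
  have hQd : Differentiable ℝ Q := hQ.differentiable (by simp)
  have hQi : ∀ i, (fun z => Q z i) = evalE (q i) := fun i => funext (hq i)
  have hD : ∀ (y v : E3) (i : Fin 3), fderiv ℝ Q y v i = ∑ j : Fin 3, evalE (pderiv j (q i)) y * v j := by
    intro y v i
    rw [fderiv_apply_coord hQd, hQi i, fderiv_evalE_apply]
  have ptan : ∑ i : Fin 3, X i * q i = 0 := by
    refine eq_zero_of_evalE_eq_zero fun y => ?_
    have h := htan y
    rw [inner_fin3, hq 0, hq 1, hq 2] at h
    simp only [Fin.sum_univ_three, evalE_add, evalE_mul, evalE_X]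
    linarith
  have pdiv : ∑ i : Fin 3, pderiv i (q i) = 0 := by
    refine eq_zero_of_evalE_eq_zero fun y => ?_
    have h := hdiv y
    rw [divergence_eq_sum_inner_fderiv (EuclideanSpace.basisFun (Fin 3) ℝ)] at h
    simp only [EuclideanSpace.basisFun_apply, EuclideanSpace.inner_single_left, map_one, one_mul, hD,
      PiLp.single_apply, mul_ite, mul_one, mul_zero, Finset.sum_ite_eq', Finset.mem_univ, if_true] at h
    simp only [Fin.sum_univ_three, evalE_add] at h ⊢
    exact h
  have pharm : ∀ i, ∑ j : Fin 3, pderiv j (pderiv j (q i)) = 0 := by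
    intro i
    have hl : lapP (q i) = 0 := by
      refine eq_zero_of_evalE_eq_zero fun y => ?_
      have h := congrArg (fun w : E3 => w i) (hharm y)
      simp only at h
      rw [laplacian_apply_coord (hQ.of_le (by norm_cast)), hQi i, laplacian_evalE] at h
      rw [h]
      simp
    rw [Fin.sum_univ_three]
    exact hl
  have ploop : ∑ i : Fin 3, X i * ((∑ j : Fin 3, C (a j) * X j * pderiv j (q i)) - C (a i) * q i) = 0 := by
    refine eq_zero_of_evalE_eq_zero fun y => ?_
    have h := hloop y
    rw [inner_fin3] at h
    simp only [PiLp.sub_apply, hT, hD, hq, Fin.sum_univ_three] at h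
    simp only [Fin.sum_univ_three, evalE_add, evalE_mul, evalE_sub, evalE_X, evalE_C]
    linarith
  obtain ⟨μ, hμ⟩ := HarmonicTangent.eq_smul_eulerTop_of_degree_two a ha hsum q hqh ptan pdiv pharm ploop
  refine ⟨μ, fun y => ?_⟩
  ext i
  rw [hq i, hμ i, evalE_mul, evalE_C, evalE_eulerTopField a T hT y i, PiLp.smul_apply, smul_eq_mul]

/-- **Degree two, general frame**: a smooth `2`-homogeneous field `P`, tangent to the spheres about `0`, divergence free, harmonic, obeying
the loop law against an `S` with orthonormal eigenbasis `u` and injective eigenvalues `e` with `Σ eᵢ = 0`, is `P(y) = μ · y × Sy`. -/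
theorem eq_smul_cross_of_jetFacts_two (P : E3 → E3) (hP : ContDiff ℝ ∞ P)
    (hhom : ∀ (c : ℝ) (y : E3), P (c • y) = c ^ 2 • P y) (hdiv : ∀ y, VectorCalculus.divergence P y = 0)
    (htan : ∀ y, ⟪y, P y⟫ = 0) (hharm : ∀ y, Laplacian.laplacian P y = 0) (S : E3 →L[ℝ] E3) (u : Fin 3 → E3) (e : Fin 3 → ℝ)
    (hu : Orthonormal ℝ u) (he : Function.Injective e) (hS : ∀ i, S (u i) = e i • u i) (htr : ∑ i, e i = 0)
    (hloop : ∀ y, ⟪y, fderiv ℝ P y (S y) - S (P y)⟫ = 0) : ∃ μ : ℝ, ∀ y, P y = μ • cross y (S y) := by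
  classical
  obtain ⟨ob, hob⟩ := exists_orthonormalBasis_eq hu
  set g : E3 ≃ₗᵢ[ℝ] E3 := ob.repr.symm with hg
  have hgsymm : ∀ (w : E3) (i : Fin 3), g.symm w i = ⟪u i, w⟫ := fun w i => by
    rw [hg, LinearIsometryEquiv.symm_symm, ob.repr_apply_apply, hob]
  have hgy : ∀ y : E3, g y = ∑ i, y i • u i := fun y => by
    rw [hg, ← ob.sum_repr_symm]
    simp only [hob]
  set Q : E3 → E3 := fun y => g.symm (P (g y)) with hQ
  set T : E3 →L[ℝ] E3 := (g.symm : E3 →L[ℝ] E3).comp (S.comp (g : E3 →L[ℝ] E3)) with hT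
  have hTap : ∀ y, T y = g.symm (S (g y)) := fun y => rfl
  have hTcoord : ∀ (w : E3) (i : Fin 3), T w i = e i * w i := by
    intro w i
    rw [hTap, hgsymm, hgy, map_sum]
    simp only [map_smul, hS, smul_smul, inner_sum, real_inner_smul_right]
    have horth : ∀ j, ⟪u i, u j⟫ = if i = j then (1 : ℝ) else 0 := fun j => by
      rw [orthonormal_iff_ite.mp hu i j]
    simp only [horth, mul_ite, mul_one, mul_zero, Finset.sum_ite_eq, Finset.mem_univ, if_true]
    ring
  have hQs : ContDiff ℝ ∞ Q :=
    (g.symm : E3 →L[ℝ] E3).contDiff.comp (hP.comp (g : E3 →L[ℝ] E3).contDiff)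
  have hQhom : ∀ (c : ℝ) (y : E3), Q (c • y) = c ^ 2 • Q y := fun c y => by
    simp only [hQ, map_smul, hhom]
  have hQdiv : ∀ y, VectorCalculus.divergence Q y = 0 := fun y => by
    have h := divergence_conj_linearIsometryEquiv g.symm P y
    simp only [LinearIsometryEquiv.symm_symm] at h
    rw [hQ, h, hdiv]
  have hQtan : ∀ y, ⟪y, Q y⟫ = 0 := fun y => by
    rw [hQ]
    show ⟪y, g.symm (P (g y))⟫ = 0
    rw [← g.inner_map_map, LinearIsometryEquiv.apply_symm_apply, htan]
  have hQharm : ∀ y, Laplacian.laplacian Q y = 0 := fun y => by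
    have h := laplacian_conj_linearIsometryEquiv g.symm P y
    simp only [LinearIsometryEquiv.symm_symm] at h
    rw [hQ, h, hharm, map_zero]
  have hQloop : ∀ y, ⟪y, fderiv ℝ Q y (T y) - T (Q y)⟫ = 0 := fun y => by
    have hfd : fderiv ℝ Q y = (g.symm : E3 →L[ℝ] E3).comp ((fderiv ℝ P (g y)).comp (g : E3 →L[ℝ] E3)) := by
      have h := fderiv_conj_linearIsometryEquiv g.symm P y
      simp only [LinearIsometryEquiv.symm_symm] at h
      rw [hQ]; exact h
    rw [hfd, hTap, hTap]
    show ⟪y, g.symm (fderiv ℝ P (g y) (g (g.symm (S (g y))))) - g.symm (S (g (g.symm (P (g y)))))⟫ = 0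
    rw [LinearIsometryEquiv.apply_symm_apply, LinearIsometryEquiv.apply_symm_apply, ← map_sub, ← g.inner_map_map,
      LinearIsometryEquiv.apply_symm_apply, hloop]
  obtain ⟨μ, hμ⟩ := eq_smul_cross_of_jetFacts_two_diag Q hQs hQhom hQdiv hQtan hQharm e he htr T hTcoord hQloop
  -- back to the original frame: `g a × g b = ε • g (a × b)`, `ε = det g = ±1`
  set ε : ℝ := ((g : E3 ≃ₗᵢ[ℝ] E3) : E3 →L[ℝ] E3).det with hε
  have hε2 : ε * ε = 1 := det_linearIsometryEquiv_mul_self g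
  refine ⟨μ * ε, fun x => ?_⟩
  have h := hμ (g.symm x)
  simp only [hQ, hTap, LinearIsometryEquiv.apply_symm_apply] at h
  -- `h : g.symm (P x) = μ • cross (g.symm x) (g.symm (S x))`
  have h2 : P x = g (μ • cross (g.symm x) (g.symm (S x))) := by
    rw [← h, LinearIsometryEquiv.apply_symm_apply]
  rw [h2, map_smul]
  have h3 : g (cross (g.symm x) (g.symm (S x))) = ε • cross x (S x) := by
    have h4 := cross_map_linearIsometryEquiv g (g.symm x) (g.symm (S x))
    rw [LinearIsometryEquiv.apply_symm_apply, LinearIsometryEquiv.apply_symm_apply] at h4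
    -- `h4 : cross x (S x) = ε • g (cross (g⁻¹ x) (g⁻¹ (S x)))`
    rw [h4, ← hε, smul_smul, hε2, one_smul]
  rw [h3, smul_smul]

end Summit.NavierStokesRegularity.NavierStokesRegularity.Theorems.PoloidalLiouville.CentreJet.TriaxialFrame

end
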